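import Mathlib
import HarnessLib

/-!
# [Balaban1987RG1] §2 p. 267: the change of variables `B′ = B − hD̃(B)` linearizing `Q̃` — existence, uniqueness, explicit
# radius, Lipschitz dependence and ANALYTICITY of `D̃` (cell topic `Summits/QuantumFields/BalabanUV/Beta/LinearizingChange267`)

HONEST FRAMING (cell rule).  Discharging `BetaPertH` makes Bałaban's UV stability UNCONDITIONAL — a real constructive-QFT
result; NOT the continuum limit, NOT the Clay problem.  This module discharges NOTHING of `BetaPertH`: it supplies, as ABSTRACT
functional analysis, a step that [I] p. 267 states BY ASSERTION with a method pointer — cell GAPS G-adv9-20 column (a), terminal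
leaf (T4)(a) of the row-D4 apex map `BETA/REMAINDER-BETA.md` §9 («analyticity radii of G₃, D̃, V by reference»): existence,
uniqueness and analyticity of the correction `D̃(B)`.  Bookkeeping-grade; NOT summit progress.  Unit `b2b-balaban-beta-an4-g30`.

CITATION HEADER (lean-in-tree rule).  [I] = T. Bałaban, *Renormalization group approach to lattice gauge field theories. I.*,
Commun. Math. Phys. **109**, 249–301 (1987) [Balaban1987RG1] (PDF page = journal page − 248).  WHAT IS REPRODUCED: p. 267
[PDF 19], read as an image (render `HOME/b2b-balaban-ref1/pages/1987-cmp109-rg-I-small-field/…-p019-x2.png`), verbatim: *"In this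
integral we make a change of variables linearizing the function Q̃(B′). This operation was discussed several times in the
previous papers, e.g. see Sect. C [15], Sect. E [14]. … Furthermore, the operator h satisfies the identity LQ̃h = I on
T^{(k+1)}. … We are looking for an analytic, 𝐠-valued function D̃(B′), defined at bonds of T^{(k+1)}, and such that the
transformation B′ = B − hD̃(B) linearizes the function Q̃(B′). The function D̃(B) is determined by the equation
LQ̃B′ + C̃(B′) = LQ̃B − D̃(B) + C̃(B − hD̃(B)) = LQ̃B.  It is easy to prove, following the proofs in the above mentioned
papers, that there exists exactly one solution of this equation, and that it is an analytic function of B. From this equation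
we obtain also that D̃(B) has an expansion beginning with quadratic terms, and D̃^{(2)}(B) = C̃^{(2)}(B)."*  ([15] =
[Balaban1985Variational] CMP 102; [14] = Bałaban, CMP 99, 75–102 (1985) — [I] p. 299, render `…-p051-x2.png`.)

ABSOLUTE RULE (cell).  "No internally-minted statement may enter as a cited fact. Every hypothesis is either kernel-proved in
this package or a verbatim quotation of a PUBLISHED theorem with page reference. The manuscript(s) under audit are NOT citable
for their own disputed steps — they are the thing under adjudication; programme-internal (2001/route/tribunal) claims are never
citable."  Nothing is cited as a fact: every declaration is a definition or is PROVED from Mathlib (Banach's fixed point theorem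
`ContractingWith.exists_fixedPoint'`, the Cⁿ/Cω implicit function theorem `ContDiffAt.implicitFunction`, the Neumann series
`Units.oneSub`).

READING (recorded as such).  `E` = 𝔤-valued functions on the bonds of T^{(k)}, `F` = the same on T^{(k+1)} (any normed spaces over
`𝕜 = ℝ` or `ℂ`, complete where Banach/IFT are used); `A : E →L F` = the printed «LQ̃», `h` its right inverse («LQ̃h = I»), `C` = the
printed non-linear part «C̃»; `linearizes_iff`: the printed equation IS the fixed-point equation `D = C(B − hD)` (algebra from `A∘h = id`).

PROVED ([folklore] analysis, constants explicit).  Under `C 0 = 0`, `C` λ-Lipschitz on the closed r-ball, `ρ + ‖h‖σ ≤ r`,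
`λr ≤ σ`, `λ‖h‖ < 1`: «exactly one solution» (`exists_fixedPoint`, `fixedPoint_unique`, `tildeD`, `tildeD_spec`,
`eq_tildeD_of_fixedPoint`, `tildeD_zero`), LIPSCHITZ dependence `norm_tildeD_sub_le` (`κ = λ/(1 − λ‖h‖)`), «expansion beginning
with quadratic terms» (`norm_tildeD_le_sq`: `‖D̃B‖ ≤ M(1 + ‖h‖κ)²‖B‖²` under `‖C x‖ ≤ M‖x‖²`; `hasFDerivAt_tildeD_zero`: `DD̃(0) = 0`),
«an analytic function of B» WITH AN EXPLICIT RADIUS (`analyticOnNhd_tildeD` on the open ρ-ball when `C` is `C^ω` on the open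
r-ball and `ρ + ‖h‖σ < r`: IFT at `(B, D̃B)` for `Φ(B,D) = D − C(B − hD)`, `∂_DΦ = id + DC∘h` invertible as `‖DC∘h‖ ≤ λ‖h‖ < 1`,
glued to `D̃` by local uniqueness + Lipschitz continuity); `exists_unique_analytic_linearizer` assembles the printed sentence.

NOT CLAIMED.  The DICTIONARY — that Bałaban's Q̃ of (2.4) splits as LQ̃ + C̃ with C̃ Lipschitz/analytic on a polydisc with
constants UNIFORM in k, the volume and the background V^{(k)} (locality per coarse bond + compactness of the group; GAPS
G-adv9-20 (b)) — a [dict]/[model] residue where the printed «absolute constant a₁»-type radii come from; `D̃^{(2)} = C̃^{(2)}`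
as an identity of second-order TERMS (only the quadratic bound and `DD̃(0) = 0` are typed); [15] Sect. C / [14] Sect. E
themselves; anything of [II]; NOT summit progress.
-/


namespace Summit.QuantumFields.BalabanUV.Beta.LinearizingChange267

open Metric Set Filter
open scoped NNReal Topology ContDiff

noncomputable section

variable {𝕜 : Type*} [RCLike 𝕜]
  {E : Type*} [NormedAddCommGroup E] [NormedSpace 𝕜 E]
  {F : Type*} [NormedAddCommGroup F] [NormedSpace 𝕜 F]

/-! ## §1 The printed equation is a fixed-point equation -/

/-- [I] p. 267: with `A ∘ h = id` («LQ̃h = I»), `A(B − hD) + C(B − hD) = AB` iff `D = C(B − hD)` — the printed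
«LQ̃B′ + C̃(B′) = LQ̃B − D̃(B) + C̃(B − hD̃(B)) = LQ̃B». [cite: Balaban1987RG1, §2 p.267] -/
theorem linearizes_iff (A : E →L[𝕜] F) (h : F →L[𝕜] E) (hAh : ∀ D, A (h D) = D) (C : E → F) (B : E) (D : F) :
    A (B - h D) + C (B - h D) = A B ↔ D = C (B - h D) := by
  rw [map_sub, hAh]
  constructor
  · intro hyp
    have h1 : A B - D + C (B - h D) - A B = 0 := sub_eq_zero.mpr hyp
    have h2 : C (B - h D) - D = 0 := by rw [← h1]; abel
    exact (sub_eq_zero.mp h2).symm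
  · intro hyp
    rw [← hyp]; abel

/-! ## §2 Banach iteration in the ball: existence, uniqueness, explicit radii -/

section Contraction

variable {C : E → F} {h : F →L[𝕜] E} {lam : ℝ≥0} {r ρ σ : ℝ}

/-- The fixed-point map `T_B(D) = C(B − hD)`. [folklore] -/
def fpMap (C : E → F) (h : F →L[𝕜] E) (B : E) (D : F) : F := C (B - h D)

/-- For `‖B‖ ≤ ρ`, `‖D‖ ≤ σ` and `ρ + ‖h‖σ ≤ r` the argument `B − hD` lies in the closed `r`-ball. [folklore] -/
theorem arg_mem_closedBall (hr : ρ + ‖h‖ * σ ≤ r) {B : E} (hB : B ∈ closedBall (0 : E) ρ)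
    {D : F} (hD : D ∈ closedBall (0 : F) σ) : B - h D ∈ closedBall (0 : E) r := by
  rw [mem_closedBall_zero_iff] at hB hD ⊢
  calc ‖B - h D‖ ≤ ‖B‖ + ‖h D‖ := norm_sub_le _ _
    _ ≤ ‖B‖ + ‖h‖ * ‖D‖ := by gcongr; exact h.le_opNorm D
    _ ≤ ρ + ‖h‖ * σ := by gcongr
    _ ≤ r := hr

/-- `T_B` maps the closed `σ`-ball into itself (`C 0 = 0`, `λr ≤ σ`). [folklore] -/
theorem mapsTo_fpMap (hC0 : C 0 = 0) (hLip : LipschitzOnWith lam C (closedBall (0 : E) r))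
    (hr : ρ + ‖h‖ * σ ≤ r) (hσ : (lam : ℝ) * r ≤ σ) {B : E} (hB : B ∈ closedBall (0 : E) ρ) :
    MapsTo (fpMap C h B) (closedBall (0 : F) σ) (closedBall (0 : F) σ) := by
  intro D hD
  have hx := arg_mem_closedBall hr hB hD
  have h0 : (0 : E) ∈ closedBall (0 : E) r := mem_closedBall_self ((norm_nonneg _).trans (mem_closedBall_zero_iff.mp hx))
  have hd := hLip.dist_le_mul _ hx _ h0
  rw [hC0, dist_zero_right, dist_zero_right] at hd
  rw [mem_closedBall_zero_iff] at hx ⊢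
  unfold fpMap
  calc ‖C (B - h D)‖ ≤ lam * ‖B - h D‖ := hd
    _ ≤ lam * r := by gcongr
    _ ≤ σ := hσ

/-- `T_B` is `λ‖h‖`-Lipschitz on the closed `σ`-ball. [folklore] -/
theorem lipschitzOnWith_fpMap (hLip : LipschitzOnWith lam C (closedBall (0 : E) r)) (hr : ρ + ‖h‖ * σ ≤ r)
    {B : E} (hB : B ∈ closedBall (0 : E) ρ) :
    LipschitzOnWith (lam * ‖h‖₊) (fpMap C h B) (closedBall (0 : F) σ) := by
  refine LipschitzOnWith.of_dist_le_mul fun D₁ hD₁ D₂ hD₂ => ?_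
  have h1 := hLip.dist_le_mul _ (arg_mem_closedBall hr hB hD₁) _ (arg_mem_closedBall hr hB hD₂)
  unfold fpMap
  refine h1.trans ?_
  rw [dist_eq_norm, dist_eq_norm, NNReal.coe_mul, coe_nnnorm]
  have : B - h D₁ - (B - h D₂) = -(h (D₁ - D₂)) := by rw [map_sub]; abel
  rw [this, norm_neg, mul_assoc]
  gcongr
  exact h.le_opNorm _

/-- **EXACTLY ONE SOLUTION, uniqueness half**: two solutions in the `σ`-ball coincide. [folklore] -/
theorem fixedPoint_unique (hLip : LipschitzOnWith lam C (closedBall (0 : E) r)) (hr : ρ + ‖h‖ * σ ≤ r)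
    (hq : (lam : ℝ) * ‖h‖ < 1) {B : E} (hB : B ∈ closedBall (0 : E) ρ) {D₁ D₂ : F}
    (hD₁ : D₁ ∈ closedBall (0 : F) σ) (hD₂ : D₂ ∈ closedBall (0 : F) σ) (h₁ : D₁ = C (B - h D₁))
    (h₂ : D₂ = C (B - h D₂)) : D₁ = D₂ := by
  have hd := (lipschitzOnWith_fpMap hLip hr hB).dist_le_mul _ hD₁ _ hD₂
  unfold fpMap at hd
  rw [← h₁, ← h₂, NNReal.coe_mul, coe_nnnorm] at hd
  have hdist : dist D₁ D₂ = 0 := by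
    nlinarith [dist_nonneg (x := D₁) (y := D₂)]
  exact dist_eq_zero.mp hdist

open Classical in
/-- **THE LINEARIZING CORRECTION `D̃`**: for `‖B‖ ≤ ρ` the solution of `D = C(B − hD)` in the σ-ball, else `0`. [cite: Balaban1987RG1, §2 p.267] -/
def tildeD (C : E → F) (h : F →L[𝕜] E) (ρ σ : ℝ) (B : E) : F :=
  if hex : B ∈ closedBall (0 : E) ρ ∧ ∃ D ∈ closedBall (0 : F) σ, D = C (B - h D) then hex.2.choose else 0

variable [CompleteSpace F]

/-- **EXACTLY ONE SOLUTION, existence** (Banach iteration in the complete σ-ball): `‖B‖ ≤ ρ ⟹ ∃ D, ‖D‖ ≤ σ ∧ D = C(B − hD)`. [folklore] -/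
theorem exists_fixedPoint (hC0 : C 0 = 0) (hLip : LipschitzOnWith lam C (closedBall (0 : E) r))
    (hr : ρ + ‖h‖ * σ ≤ r) (hσ : (lam : ℝ) * r ≤ σ) (hσ0 : 0 ≤ σ) (hq : (lam : ℝ) * ‖h‖ < 1)
    {B : E} (hB : B ∈ closedBall (0 : E) ρ) :
    ∃ D ∈ closedBall (0 : F) σ, D = C (B - h D) := by
  have hmaps := mapsTo_fpMap hC0 hLip hr hσ hB
  have hK : ContractingWith (lam * ‖h‖₊) (hmaps.restrict (fpMap C h B) _ _) :=
    ⟨by exact_mod_cast hq, (lipschitzOnWith_fpMap hLip hr hB).mapsToRestrict hmaps⟩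
  have h0 : (0 : F) ∈ closedBall (0 : F) σ := by simp [hσ0]
  obtain ⟨D, hDs, hfix, -⟩ :=
    hK.exists_fixedPoint' isClosed_closedBall.isComplete hmaps h0 (edist_ne_top _ _)
  exact ⟨D, hDs, hfix.symm⟩

/-- `D̃B` lies in the `σ`-ball and solves the equation (for `‖B‖ ≤ ρ`). [folklore] -/
theorem tildeD_spec (hC0 : C 0 = 0) (hLip : LipschitzOnWith lam C (closedBall (0 : E) r))
    (hr : ρ + ‖h‖ * σ ≤ r) (hσ : (lam : ℝ) * r ≤ σ) (hσ0 : 0 ≤ σ) (hq : (lam : ℝ) * ‖h‖ < 1)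
    {B : E} (hB : B ∈ closedBall (0 : E) ρ) :
    tildeD C h ρ σ B ∈ closedBall (0 : F) σ ∧ tildeD C h ρ σ B = C (B - h (tildeD C h ρ σ B)) := by
  have hex : B ∈ closedBall (0 : E) ρ ∧ ∃ D ∈ closedBall (0 : F) σ, D = C (B - h D) :=
    ⟨hB, exists_fixedPoint hC0 hLip hr hσ hσ0 hq hB⟩
  rw [show tildeD C h ρ σ B = hex.2.choose by unfold tildeD; exact dif_pos hex]
  exact hex.2.choose_spec

/-- Any solution in the `σ`-ball IS `D̃B` («exactly one solution»). [cite: Balaban1987RG1, §2 p.267] -/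
theorem eq_tildeD_of_fixedPoint (hC0 : C 0 = 0) (hLip : LipschitzOnWith lam C (closedBall (0 : E) r))
    (hr : ρ + ‖h‖ * σ ≤ r) (hσ : (lam : ℝ) * r ≤ σ) (hσ0 : 0 ≤ σ) (hq : (lam : ℝ) * ‖h‖ < 1)
    {B : E} (hB : B ∈ closedBall (0 : E) ρ) {D : F} (hD : D ∈ closedBall (0 : F) σ) (hfix : D = C (B - h D)) :
    D = tildeD C h ρ σ B :=
  fixedPoint_unique hLip hr hq hB hD (tildeD_spec hC0 hLip hr hσ hσ0 hq hB).1 hfix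
    (tildeD_spec hC0 hLip hr hσ hσ0 hq hB).2

/-- `D̃(0) = 0`. [folklore] -/
theorem tildeD_zero (hC0 : C 0 = 0) (hLip : LipschitzOnWith lam C (closedBall (0 : E) r))
    (hr : ρ + ‖h‖ * σ ≤ r) (hσ : (lam : ℝ) * r ≤ σ) (hσ0 : 0 ≤ σ) (hρ0 : 0 ≤ ρ) (hq : (lam : ℝ) * ‖h‖ < 1) :
    tildeD C h ρ σ (0 : E) = 0 := by
  have hB : (0 : E) ∈ closedBall (0 : E) ρ := by simp [hρ0]
  have h0 : (0 : F) ∈ closedBall (0 : F) σ := by simp [hσ0]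
  exact (eq_tildeD_of_fixedPoint hC0 hLip hr hσ hσ0 hq hB h0 (by simp [hC0])).symm

/-- **LIPSCHITZ DEPENDENCE**: `‖D̃B₁ − D̃B₂‖ ≤ κ‖B₁ − B₂‖` on the `ρ`-ball, `κ = λ/(1 − λ‖h‖)`. [folklore] -/
theorem norm_tildeD_sub_le (hC0 : C 0 = 0) (hLip : LipschitzOnWith lam C (closedBall (0 : E) r))
    (hr : ρ + ‖h‖ * σ ≤ r) (hσ : (lam : ℝ) * r ≤ σ) (hσ0 : 0 ≤ σ) (hq : (lam : ℝ) * ‖h‖ < 1)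
    {B₁ B₂ : E} (hB₁ : B₁ ∈ closedBall (0 : E) ρ) (hB₂ : B₂ ∈ closedBall (0 : E) ρ) :
    ‖tildeD C h ρ σ B₁ - tildeD C h ρ σ B₂‖ ≤ lam / (1 - lam * ‖h‖) * ‖B₁ - B₂‖ := by
  set D₁ := tildeD C h ρ σ B₁ with hD₁
  set D₂ := tildeD C h ρ σ B₂ with hD₂
  obtain ⟨hD₁s, hD₁e⟩ := tildeD_spec hC0 hLip hr hσ hσ0 hq hB₁
  obtain ⟨hD₂s, hD₂e⟩ := tildeD_spec hC0 hLip hr hσ hσ0 hq hB₂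
  have hd := hLip.dist_le_mul _ (arg_mem_closedBall hr hB₁ hD₁s) _ (arg_mem_closedBall hr hB₂ hD₂s)
  rw [dist_eq_norm, dist_eq_norm, ← hD₁e, ← hD₂e] at hd
  have hsplit : ‖B₁ - h D₁ - (B₂ - h D₂)‖ ≤ ‖B₁ - B₂‖ + ‖h‖ * ‖D₁ - D₂‖ := by
    have : B₁ - h D₁ - (B₂ - h D₂) = (B₁ - B₂) - h (D₁ - D₂) := by rw [map_sub]; abel
    rw [this]
    exact (norm_sub_le _ _).trans (by gcongr; exact h.le_opNorm _)
  have hpos : 0 < 1 - (lam : ℝ) * ‖h‖ := by linarith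
  rw [div_mul_eq_mul_div, le_div_iff₀ hpos]
  have hl0 : (0 : ℝ) ≤ lam := lam.coe_nonneg
  nlinarith [hd, hsplit, mul_le_mul_of_nonneg_left hsplit hl0, norm_nonneg (D₁ - D₂), norm_nonneg h]

/-- Size: `‖D̃B‖ ≤ κ‖B‖` on the `ρ`-ball (`κ = λ/(1 − λ‖h‖)`). [folklore] -/
theorem norm_tildeD_le (hC0 : C 0 = 0) (hLip : LipschitzOnWith lam C (closedBall (0 : E) r))
    (hr : ρ + ‖h‖ * σ ≤ r) (hσ : (lam : ℝ) * r ≤ σ) (hσ0 : 0 ≤ σ) (hρ0 : 0 ≤ ρ) (hq : (lam : ℝ) * ‖h‖ < 1)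
    {B : E} (hB : B ∈ closedBall (0 : E) ρ) :
    ‖tildeD C h ρ σ B‖ ≤ lam / (1 - lam * ‖h‖) * ‖B‖ := by
  have h0 : (0 : E) ∈ closedBall (0 : E) ρ := by simp [hρ0]
  have := norm_tildeD_sub_le hC0 hLip hr hσ hσ0 hq hB h0
  rwa [tildeD_zero hC0 hLip hr hσ hσ0 hρ0 hq, sub_zero, sub_zero] at this

/-- **«EXPANSION BEGINNING WITH QUADRATIC TERMS»**: `‖C x‖ ≤ M‖x‖²` on the r-ball ⟹ `‖D̃B‖ ≤ M(1 + ‖h‖κ)²‖B‖²` on the ρ-ball. [cite: Balaban1987RG1, §2 p.267] -/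
theorem norm_tildeD_le_sq (hC0 : C 0 = 0) (hLip : LipschitzOnWith lam C (closedBall (0 : E) r))
    (hr : ρ + ‖h‖ * σ ≤ r) (hσ : (lam : ℝ) * r ≤ σ) (hσ0 : 0 ≤ σ) (hρ0 : 0 ≤ ρ) (hq : (lam : ℝ) * ‖h‖ < 1)
    {M : ℝ} (hM : 0 ≤ M) (hquad : ∀ x ∈ closedBall (0 : E) r, ‖C x‖ ≤ M * ‖x‖ ^ 2)
    {B : E} (hB : B ∈ closedBall (0 : E) ρ) :
    ‖tildeD C h ρ σ B‖ ≤ M * (1 + ‖h‖ * (lam / (1 - lam * ‖h‖))) ^ 2 * ‖B‖ ^ 2 := by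
  set κ : ℝ := lam / (1 - lam * ‖h‖) with hκ
  obtain ⟨hDs, hDe⟩ := tildeD_spec hC0 hLip hr hσ hσ0 hq hB
  set D := tildeD C h ρ σ B with hD
  have hx := arg_mem_closedBall hr hB hDs
  have h1 : ‖D‖ ≤ M * ‖B - h D‖ ^ 2 := by rw [hDe]; exact (hquad _ hx).trans (by rw [← hDe])
  have hκB : ‖D‖ ≤ κ * ‖B‖ := norm_tildeD_le hC0 hLip hr hσ hσ0 hρ0 hq hB
  have h2 : ‖B - h D‖ ≤ (1 + ‖h‖ * κ) * ‖B‖ := by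
    calc ‖B - h D‖ ≤ ‖B‖ + ‖h‖ * ‖D‖ := (norm_sub_le _ _).trans (by gcongr; exact h.le_opNorm _)
      _ ≤ ‖B‖ + ‖h‖ * (κ * ‖B‖) := by gcongr
      _ = (1 + ‖h‖ * κ) * ‖B‖ := by ring
  calc ‖D‖ ≤ M * ‖B - h D‖ ^ 2 := h1
    _ ≤ M * ((1 + ‖h‖ * κ) * ‖B‖) ^ 2 := by gcongr
    _ = M * (1 + ‖h‖ * κ) ^ 2 * ‖B‖ ^ 2 := by ring

/-- Hence `D̃` is differentiable at `0` with derivative `0` (no linear term). [folklore] -/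
theorem hasFDerivAt_tildeD_zero (hC0 : C 0 = 0) (hLip : LipschitzOnWith lam C (closedBall (0 : E) r))
    (hr : ρ + ‖h‖ * σ ≤ r) (hσ : (lam : ℝ) * r ≤ σ) (hσ0 : 0 ≤ σ) (hρ0 : 0 < ρ) (hq : (lam : ℝ) * ‖h‖ < 1)
    {M : ℝ} (hM : 0 ≤ M) (hquad : ∀ x ∈ closedBall (0 : E) r, ‖C x‖ ≤ M * ‖x‖ ^ 2) :
    HasFDerivAt (tildeD C h ρ σ) (0 : E →L[𝕜] F) 0 := by
  rw [hasFDerivAt_iff_isLittleO_nhds_zero]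
  have hfun : (fun B : E => tildeD C h ρ σ (0 + B) - tildeD C h ρ σ 0 - (0 : E →L[𝕜] F) B) =
      fun B => tildeD C h ρ σ B := by
    funext B; simp [tildeD_zero hC0 hLip hr hσ hσ0 hρ0.le hq]
  rw [hfun]
  set K : ℝ := M * (1 + ‖h‖ * (lam / (1 - lam * ‖h‖))) ^ 2 with hK
  have hbig : (fun B => tildeD C h ρ σ B) =O[𝓝 0] (fun B : E => ‖B‖ ^ 2) := by
    refine Asymptotics.IsBigO.of_bound K ?_
    filter_upwards [Metric.closedBall_mem_nhds (0 : E) hρ0] with B hB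
    rw [Real.norm_of_nonneg (by positivity)]
    exact norm_tildeD_le_sq hC0 hLip hr hσ hσ0 hρ0.le hq hM hquad hB
  exact hbig.trans_isLittleO (Asymptotics.isLittleO_norm_pow_id one_lt_two)

end Contraction

/-! ## §3 ANALYTICITY with an explicit radius (implicit function theorem + Neumann series + uniqueness) -/

section Analytic

variable {C : E → F} {h : F →L[𝕜] E} {lam : ℝ≥0} {r ρ σ : ℝ}

/-- The implicit equation `Φ(B, D) = D − C(B − hD)`. [folklore] -/
def Phi (C : E → F) (h : F →L[𝕜] E) (p : E × F) : F := p.2 - C (p.1 - h p.2)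

/-- `Φ` is `C^ω` at `(B, D)` when `C` is `C^ω` at `B − hD`. [folklore] -/
theorem contDiffAt_Phi {p : E × F} (hC : ContDiffAt 𝕜 ω C (p.1 - h p.2)) : ContDiffAt 𝕜 ω (Phi C h) p := by
  unfold Phi
  have hlin : ContDiffAt 𝕜 ω (fun q : E × F => q.1 - h q.2) p := by fun_prop
  exact contDiffAt_snd.sub (hC.comp p hlin)

/-- The partial derivative of `Φ` in `D` at `p` is `id + DC(p.1 − h p.2) ∘ h`. [folklore] -/
theorem fderiv_Phi_inr {p : E × F} (hC : ContDiffAt 𝕜 ω C (p.1 - h p.2)) :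
    fderiv 𝕜 (Phi C h) p ∘L ContinuousLinearMap.inr 𝕜 E F =
      ContinuousLinearMap.id 𝕜 F + (fderiv 𝕜 C (p.1 - h p.2)) ∘L h := by
  have hCd : DifferentiableAt 𝕜 C (p.1 - h p.2) := hC.differentiableAt (by simp)
  have hlin : HasFDerivAt (fun q : E × F => q.1 - h q.2)
      (ContinuousLinearMap.fst 𝕜 E F - h ∘L ContinuousLinearMap.snd 𝕜 E F) p := by
    exact (hasFDerivAt_fst).sub (h.hasFDerivAt.comp p hasFDerivAt_snd)
  have hcomp : HasFDerivAt (fun q : E × F => C (q.1 - h q.2))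
      ((fderiv 𝕜 C (p.1 - h p.2)) ∘L (ContinuousLinearMap.fst 𝕜 E F - h ∘L ContinuousLinearMap.snd 𝕜 E F)) p :=
    hCd.hasFDerivAt.comp p hlin
  have hPhi : HasFDerivAt (Phi C h)
      (ContinuousLinearMap.snd 𝕜 E F -
        (fderiv 𝕜 C (p.1 - h p.2)) ∘L (ContinuousLinearMap.fst 𝕜 E F - h ∘L ContinuousLinearMap.snd 𝕜 E F)) p :=
    hasFDerivAt_snd.sub hcomp
  rw [hPhi.fderiv]
  ext v
  simp

/-- Neumann series: `‖DC(x)∘h‖ < 1` makes `id + DC(x)∘h` invertible. [folklore] -/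
theorem isInvertible_id_add [CompleteSpace F] {T : E →L[𝕜] F} (hT : ‖T ∘L h‖ < 1) :
    (ContinuousLinearMap.id 𝕜 F + T ∘L h).IsInvertible := by
  have hunit : IsUnit (ContinuousLinearMap.id 𝕜 F + T ∘L h) := by
    have := (Units.oneSub (-(T ∘L h)) (by rwa [norm_neg])).isUnit
    rw [Units.val_oneSub, sub_neg_eq_add, ContinuousLinearMap.one_def] at this
    exact this
  obtain ⟨u, hu⟩ := hunit
  exact ⟨ContinuousLinearEquiv.ofUnit u, by rw [← hu]; rfl⟩

/-- On the open `r`-ball a Lipschitz `C^ω` map has `‖DC(x)‖ ≤ λ`, hence `‖DC(x)∘h‖ ≤ λ‖h‖`. [folklore] -/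
theorem norm_fderiv_comp_le (hLip : LipschitzOnWith lam C (closedBall (0 : E) r)) {x : E} (hx : x ∈ ball (0 : E) r) :
    ‖(fderiv 𝕜 C x) ∘L h‖ ≤ lam * ‖h‖ := by
  have hnhds : closedBall (0 : E) r ∈ 𝓝 x := mem_of_superset (isOpen_ball.mem_nhds hx) ball_subset_closedBall
  have h1 : ‖fderiv 𝕜 C x‖ ≤ lam := norm_fderiv_le_of_lipschitzOn 𝕜 hnhds hLip
  exact (ContinuousLinearMap.opNorm_comp_le _ _).trans (by gcongr)

variable [CompleteSpace E] [CompleteSpace F]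

/-- **«IT IS AN ANALYTIC FUNCTION OF B»**, with an explicit radius: under the contraction data of §2, `ρ + ‖h‖σ < r` and `C`
of class `C^ω` on the open `r`-ball, `D̃` is analytic at every `B` with `‖B‖ < ρ` (analytic IFT for `Φ` at `(B, D̃B)`, Neumann
series for `∂_DΦ`, identification with `D̃` by local uniqueness + Lipschitz continuity). [cite: Balaban1987RG1, §2 p.267] -/
theorem analyticAt_tildeD (hC0 : C 0 = 0) (hLip : LipschitzOnWith lam C (closedBall (0 : E) r))
    (hr : ρ + ‖h‖ * σ < r) (hσ : (lam : ℝ) * r ≤ σ) (hσ0 : 0 ≤ σ) (hq : (lam : ℝ) * ‖h‖ < 1)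
    (hCω : ∀ x ∈ ball (0 : E) r, ContDiffAt 𝕜 ω C x) {B₀ : E} (hB₀ : B₀ ∈ ball (0 : E) ρ) :
    AnalyticAt 𝕜 (tildeD C h ρ σ) B₀ := by
  have hB₀' : B₀ ∈ closedBall (0 : E) ρ := ball_subset_closedBall hB₀
  set D₀ := tildeD C h ρ σ B₀ with hD₀
  obtain ⟨hD₀s, hD₀e⟩ := tildeD_spec hC0 hLip hr.le hσ hσ0 hq hB₀'
  -- the argument x₀ = B₀ - h D₀ is in the OPEN r-ball
  have hx₀ : B₀ - h D₀ ∈ ball (0 : E) r := by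
    rw [mem_ball_zero_iff]
    rw [mem_ball_zero_iff] at hB₀
    rw [mem_closedBall_zero_iff] at hD₀s
    calc ‖B₀ - h D₀‖ ≤ ‖B₀‖ + ‖h‖ * ‖D₀‖ := (norm_sub_le _ _).trans (by gcongr; exact h.le_opNorm _)
      _ < ρ + ‖h‖ * σ := by
          have : ‖h‖ * ‖D₀‖ ≤ ‖h‖ * σ := by gcongr
          linarith
      _ ≤ r := hr.le
  set p₀ : E × F := (B₀, D₀) with hp₀
  have hCp : ContDiffAt 𝕜 ω C (p₀.1 - h p₀.2) := hCω _ hx₀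
  have hΦ : ContDiffAt 𝕜 ω (Phi C h) p₀ := contDiffAt_Phi hCp
  have hinv : (fderiv 𝕜 (Phi C h) p₀ ∘L ContinuousLinearMap.inr 𝕜 E F).IsInvertible := by
    rw [fderiv_Phi_inr hCp]
    exact isInvertible_id_add ((norm_fderiv_comp_le hLip hx₀).trans_lt hq)
  have hω : (ω : ℕ∞ω) ≠ 0 := by simp
  set ψ := hΦ.implicitFunction hω hinv with hψ
  -- ψ is analytic at B₀, and near (B₀, D₀) the zero set of Φ - Φ p₀ is the graph of ψ
  have hψω : ContDiffAt 𝕜 ω ψ B₀ := hΦ.contDiffAt_implicitFunction hω hinv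
  have huniq := hΦ.eventually_apply_eq_iff_implicitFunction hω hinv
  have hΦ0 : Phi C h p₀ = 0 := by
    show D₀ - C (B₀ - h D₀) = 0
    rw [hD₀, sub_eq_zero]
    exact hD₀e
  -- D̃ is continuous at B₀ (Lipschitz on the ρ-ball, a neighbourhood of B₀)
  have hcont : ContinuousAt (tildeD C h ρ σ) B₀ := by
    have hnhds : closedBall (0 : E) ρ ∈ 𝓝 B₀ := mem_of_superset (isOpen_ball.mem_nhds hB₀) ball_subset_closedBall
    have hLipD : LipschitzOnWith (Real.toNNReal (lam / (1 - lam * ‖h‖))) (tildeD C h ρ σ) (closedBall (0 : E) ρ) := by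
      refine LipschitzOnWith.of_dist_le_mul fun B₁ hB₁ B₂ hB₂ => ?_
      rw [dist_eq_norm, dist_eq_norm]
      have hκ0 : 0 ≤ (lam : ℝ) / (1 - lam * ‖h‖) := div_nonneg lam.coe_nonneg (by linarith)
      rw [Real.coe_toNNReal _ hκ0]
      exact norm_tildeD_sub_le hC0 hLip hr.le hσ hσ0 hq hB₁ hB₂
    exact (hLipD.continuousOn.continuousAt hnhds)
  -- hence (B, D̃ B) → p₀ and the uniqueness clause applies along B → B₀
  have htend : Tendsto (fun B => (B, tildeD C h ρ σ B)) (𝓝 B₀) (𝓝 p₀) :=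
    (continuous_id.tendsto B₀).prodMk_nhds hcont
  have hev : ∀ᶠ B in 𝓝 B₀, tildeD C h ρ σ B = ψ B := by
    have h1 := htend.eventually huniq
    have h2 : ∀ᶠ B in 𝓝 B₀, B ∈ closedBall (0 : E) ρ :=
      mem_of_superset (isOpen_ball.mem_nhds hB₀) ball_subset_closedBall
    filter_upwards [h1, h2] with B hB hBρ
    have hsol : Phi C h (B, tildeD C h ρ σ B) = Phi C h p₀ := by
      rw [hΦ0]
      have := (tildeD_spec hC0 hLip hr.le hσ hσ0 hq hBρ).2
      simp [Phi, ← this]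
    exact (hB.mp hsol).symm
  exact (hψω.congr_of_eventuallyEq hev).analyticAt

/-- `D̃` is analytic on the whole open `ρ`-ball (explicit radius). [cite: Balaban1987RG1, §2 p.267] -/
theorem analyticOnNhd_tildeD (hC0 : C 0 = 0) (hLip : LipschitzOnWith lam C (closedBall (0 : E) r))
    (hr : ρ + ‖h‖ * σ < r) (hσ : (lam : ℝ) * r ≤ σ) (hσ0 : 0 ≤ σ) (hq : (lam : ℝ) * ‖h‖ < 1)
    (hCω : ∀ x ∈ ball (0 : E) r, ContDiffAt 𝕜 ω C x) :
    AnalyticOnNhd 𝕜 (tildeD C h ρ σ) (ball (0 : E) ρ) :=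
  fun _ hB => analyticAt_tildeD hC0 hLip hr hσ hσ0 hq hCω hB

end Analytic

/-! ## §4 The printed sentence, assembled -/

/-- **[I] p. 267 ASSEMBLED**: given `A ∘ h = id` and the non-linear part `C` (λ-Lipschitz and `C^ω` on the r-ball, `C 0 = 0`),
radii `ρ + ‖h‖σ < r`, `λr ≤ σ`, `λ‖h‖ < 1`: `D̃` (i) solves the printed equation `A(B − hD̃B) + C(B − hD̃B) = AB` for `‖B‖ ≤ ρ`,
(ii) is the ONLY solution with `‖D‖ ≤ σ`, (iii) vanishes at 0, (iv) is analytic on the open ρ-ball.  The identification of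
`A, h, C` with Bałaban's `LQ̃, h, C̃` and the uniformity of `λ, r` in the step are NOT part of it. [cite: Balaban1987RG1, §2 p.267] -/
theorem exists_unique_analytic_linearizer [CompleteSpace E] [CompleteSpace F]
    (A : E →L[𝕜] F) (h : F →L[𝕜] E) (hAh : ∀ D, A (h D) = D)
    {C : E → F} {lam : ℝ≥0} {r ρ σ : ℝ} (hC0 : C 0 = 0) (hLip : LipschitzOnWith lam C (closedBall (0 : E) r))
    (hr : ρ + ‖h‖ * σ < r) (hσ : (lam : ℝ) * r ≤ σ) (hσ0 : 0 ≤ σ) (hρ0 : 0 ≤ ρ) (hq : (lam : ℝ) * ‖h‖ < 1)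
    (hCω : ∀ x ∈ ball (0 : E) r, ContDiffAt 𝕜 ω C x) :
    (∀ B ∈ closedBall (0 : E) ρ,
        A (B - h (tildeD C h ρ σ B)) + C (B - h (tildeD C h ρ σ B)) = A B) ∧
      (∀ B ∈ closedBall (0 : E) ρ, ∀ D ∈ closedBall (0 : F) σ,
        A (B - h D) + C (B - h D) = A B → D = tildeD C h ρ σ B) ∧
      tildeD C h ρ σ 0 = 0 ∧ AnalyticOnNhd 𝕜 (tildeD C h ρ σ) (ball (0 : E) ρ) := by
  refine ⟨fun B hB => ?_, fun B hB D hD hsol => ?_, tildeD_zero hC0 hLip hr.le hσ hσ0 hρ0 hq,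
    analyticOnNhd_tildeD hC0 hLip hr hσ hσ0 hq hCω⟩
  · exact (linearizes_iff A h hAh C B _).mpr (tildeD_spec hC0 hLip hr.le hσ hσ0 hq hB).2
  · exact eq_tildeD_of_fixedPoint hC0 hLip hr.le hσ hσ0 hq hB hD ((linearizes_iff A h hAh C B D).mp hsol)

end

end Summit.QuantumFields.BalabanUV.Beta.LinearizingChange267
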